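import Summits.Ventures.PercRepro.RankLevelSetTheoremCFull
import Summits.Ventures.PercRepro.RankLevelSetCoreLarge

/-!
# PercRepro — THEOREM C∞: C-025 for EVERY finite matroid at large rank, EVERY corank, every level (night-1, gen 3)

`proofs/NIGHT-1-C025-induction.md` §14. Theorem C (`exists_P_c025_bounded`, d75) gives C-025 at level `q` for all
matroids with `p ≥ P(q, D)` and corank `|E| − p ≤ D`; its `|E|`-induction `rls_succ_bounded` cannot leave the bounded
corank because its core (`Prop C₀`) counts with the nullity. Here:

* **`rls_succ_large`** — the `|E|`-induction at level `q + 1` with a threshold on `p` and NO corank bound: below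
  corank `D` Theorem C at level `q + 1` (`hsmall`); a loop halves (`RLS_of_loop_q`); an element WITHOUT an `e`-free
  partition (a parallel element in particular) is Theorem F with `D_e = 0` (`RLS_of_unspanned_q`: `M ＼ e` by the
  induction, `M ／ e` at level `q` and rank `p − 1` by `hprev`); rank `< p` is empty, rank `> p` is truncated to rank
  `p` (Theorem K) and the truncation runs the same dichotomy; what remains is the CORE `hcore` — rank `p`, corank
  `> D`, EVERY element with an `e`-free partition (coloops included: a coloop lies in no closure of a set avoiding it,
  so it always has one — this is why no coloop step, which would lower `p` below the threshold, is needed);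
* **`exists_P_c025_all_corank`** — **THEOREM C∞**: for every `q ≥ 2` there is `P` such that EVERY finite matroid
  satisfies `Φ(p, q)·#U(p, q) ≤ #Y(p, q)` for EVERY `p ≥ P` — no corank restriction. Induction on `q` from Theorem N
  (`c025_two_all`): `hsmall` = Theorem C with `D = 2q + 2^q`, `hcore` = `exists_P_core_all_corank`
  (`RankLevelSetCoreLarge`), `hprev` = the induction hypothesis.
So C-025 at every fixed level `q ≥ 2` is now open only for `p < P(q)` — finitely many `p` per level, each a
statement about matroids of all sizes (the cell's proved cells `(5,3)`, `(6,3)`, `(6,4)` are such `p`).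
Axioms: standard.
-/

open scoped Matroid

namespace PercRepro

namespace ThmN

variable {α : Type}

/-- **The unbounded-corank reduction at level `q + 1` with a threshold on `p`**: from level `q` for all matroids
with `P ≤ p` (`hprev`), level `q + 1` for all matroids with `P ≤ p` and `|E| ≤ p + D` (`hsmall`, Theorem C), and
the core at rank `p ≥ P`, corank `> D`, every element with an `e`-free partition (`hcore`), the level `q + 1` for
all matroids with `P + 1 ≤ p`. -/
theorem rls_succ_large (q D P : ℕ)
    (hprev : ∀ (M : Matroid α) [M.Finite] (p : ℕ), P ≤ p → q + 2 ≤ p → RLS M p q)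
    (hsmall : ∀ (M : Matroid α) [M.Finite] (p : ℕ), P ≤ p → M.E.ncard ≤ p + D → q + 3 ≤ p →
      RLS M p (q + 1))
    (hcore : ∀ (M : Matroid α) [M.Finite] (p : ℕ), P ≤ p → M.eRank = (p : ℕ∞) → p + D < M.E.ncard →
      q + 3 ≤ p →
      (∀ e ∈ M.E, ∃ A ⊆ M.E \ {e}, e ∉ M.closure A ∧ e ∉ M.closure ((M.E \ {e}) \ A)) →
      RLS M p (q + 1)) :
    ∀ (M : Matroid α) [M.Finite] (p : ℕ), P + 1 ≤ p → q + 3 ≤ p → RLS M p (q + 1) := by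
  suffices H : ∀ n : ℕ, ∀ (M : Matroid α) [M.Finite], M.E.ncard = n → ∀ p : ℕ, P + 1 ≤ p → q + 3 ≤ p →
      RLS M p (q + 1) from fun M _ p hP hp => H _ M rfl p hP hp
  intro n
  induction n using Nat.strong_induction_on with
  | _ n ih =>
  intro M _ hn p hP hp
  classical
  -- Case 0: bounded corank — Theorem C
  by_cases hD : n ≤ p + D
  · exact hsmall M p (by omega) (by omega) hp
  push Not at hD
  have hdel : ∀ e ∈ M.E, (M ＼ {e}).E.ncard < n := by
    intro e he
    rw [_root_.Matroid.delete_ground, ← hn, ← Set.ncard_sdiff_singleton_add_one he M.ground_finite]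
    omega
  -- Case 1: a loop (same `p`, one element fewer)
  by_cases hL : ∃ e ∈ M.E, M.IsLoop e
  · obtain ⟨e, he, hloopE⟩ := hL
    exact RLS_of_loop_q M hloopE p (q + 1) (ih _ (hdel e he) (M ＼ {e}) rfl p hP hp)
  push Not at hL
  -- Case 2: loopless, rank `p` — an element without an `e`-free partition closes the step; otherwise the core.
  -- Stated for every matroid `N` on the ground set of `M` (for `M` itself and for its truncation).
  have hrank : ∀ (N : Matroid α) [N.Finite], N.E = M.E → N.eRank = (p : ℕ∞) → (∀ e ∈ N.E, N.Indep {e}) →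
      RLS N p (q + 1) := by
    intro N _ hNE hNR hNI
    by_cases hU : ∃ e ∈ N.E, ∀ A ⊆ N.E \ {e}, e ∈ N.closure A ∨ e ∈ N.closure ((N.E \ {e}) \ A)
    · obtain ⟨e, he, hunsp⟩ := hU
      have hdelN : (N ＼ {e}).E.ncard < n := by
        rw [_root_.Matroid.delete_ground, hNE, ← hn,
          ← Set.ncard_sdiff_singleton_add_one (hNE ▸ he) M.ground_finite]
        omega
      obtain ⟨p', rfl⟩ : ∃ p', p = p' + 1 := ⟨p - 1, by omega⟩
      exact RLS_of_unspanned_q N (hNI e he) hunsp (ih _ hdelN (N ＼ {e}) rfl (p' + 1) hP hp)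
        (hprev (N ／ {e}) p' (by omega) (by omega))
    · push Not at hU
      refine hcore N p (by omega) hNR (by rw [hNE, hn]; omega) hp (fun e he => ?_)
      obtain ⟨A, hA, h⟩ := hU e he
      exact ⟨A, hA, h.1, h.2⟩
  have hMI : ∀ e ∈ M.E, M.Indep {e} :=
    fun e he => _root_.Matroid.indep_singleton.2 ((_root_.Matroid.not_isLoop_iff he).1 (hL e he))
  rcases lt_trichotomy M.eRank (p : ℕ∞) with hlt | heq | hgt
  · exact RLS_of_eRank_lt M hlt
  · exact hrank M rfl heq hMI
  · -- `r(E) > p`: truncate to rank `p` (same ground set, same size; singletons stay independent)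
    set T := Matroid.truncate M p with hTdef
    have hTR := truncate_eRank_eq M hgt
    have hTE : T.E = M.E := Matroid.truncate_ground M p
    have hTI : ∀ e ∈ T.E, T.Indep {e} := by
      intro e he
      have heM : e ∈ M.E := hTE ▸ he
      rw [Matroid.truncate_indep_iff]
      refine ⟨hMI e heM, ?_⟩
      rw [Set.ncard_singleton]; omega
    have hT : RLS T p (q + 1) := hrank T hTE hTR hTI
    unfold RLS at hT ⊢
    exact Matroid.rls_of_truncate M p (by omega) (phiK p (q + 1)) (by unfold phiK; positivity) hT

/-- **THEOREM C∞** (C-025 at large rank and EVERY corank): for every `q ≥ 2` there is a threshold `P` such that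
every finite matroid `M` and every `p ≥ P` with `q + 2 ≤ p` satisfy `Φ(p, q)·#U(p, q) ≤ #Y(p, q)` — with no
restriction on the corank `|E| − p`. -/
theorem exists_P_c025_all_corank (q : ℕ) (hq : 2 ≤ q) :
    ∃ P : ℕ, ∀ {α : Type} (M : Matroid α) [M.Finite] (p : ℕ), P ≤ p → q + 2 ≤ p → RLS M p q := by
  induction q with
  | zero => exact absurd hq (by omega)
  | succ q ihq =>
  rcases Nat.lt_or_ge q 2 with hq2 | hq2
  · -- `q + 1 = 2`: Theorem N at level `2`
    have hq1 : q = 1 := by omega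
    subst hq1
    exact ⟨0, fun M _ p _ hp => c025_two_all M p (by omega)⟩
  · obtain ⟨P₀, hP₀⟩ := ihq hq2
    obtain ⟨P₁, hP₁⟩ := exists_P_c025_bounded (q + 1) (2 * (q + 1) + 2 ^ (q + 1)) (by omega)
    obtain ⟨P₂, hP₂⟩ := exists_P_core_all_corank (q + 1) (by omega)
    refine ⟨max P₀ (max P₁ P₂) + 1, ?_⟩
    intro α M _ p hPp hp
    refine rls_succ_large q (2 * (q + 1) + 2 ^ (q + 1)) (max P₀ (max P₁ P₂)) ?_ ?_ ?_ M p hPp hp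
    · intro M' _ p' hP' hp'
      exact hP₀ M' p' (le_trans (le_max_left _ _) hP') hp'
    · intro M' _ p' hP' hD' hp'
      exact hP₁ M' p' (le_trans (le_max_left _ _) (le_trans (le_max_right _ _) hP')) hD' hp'
    · intro M' _ p' hP' hR' hbig hp' hfree
      exact hP₂ M' p' (le_trans (le_max_right _ _) (le_trans (le_max_right _ _) hP')) hR' hbig hfree

/-- **THEOREM C∞ in the vocabulary of `C025`**: for every `q ≥ 2` there is `P` such that for every finite matroid and
every `p ≥ P`, `Φ(p, q) · #{A ⊆ E : r(A) = p, r(E ∖ A) = q} ≤ #{A ⊆ E : q < r(A) < p}`. -/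
theorem c025_all_corank_of_large_rank (q : ℕ) (hq : 2 ≤ q) :
    ∃ P : ℕ, ∀ {α : Type} (M : Matroid α) [M.Finite] (p : ℕ), P ≤ p →
      phiK p q * ({A : Set α | A ⊆ M.E ∧ M.eRk A = (p : ℕ∞) ∧ M.eRk (M.E \ A) = (q : ℕ∞)}.ncard : ℚ) ≤
        ({A : Set α | A ⊆ M.E ∧ (q : ℕ∞) < M.eRk A ∧ M.eRk A < (p : ℕ∞)}.ncard : ℚ) := by
  obtain ⟨P, hP⟩ := exists_P_c025_all_corank q hq
  exact ⟨max P (q + 2), fun M _ p hp => hP M p (le_trans (le_max_left _ _) hp) (le_trans (le_max_right _ _) hp)⟩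

end ThmN

end PercRepro
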